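import Summits.HodgeConjecture.HodgeConjecture.Theorems.F0P2oThetaTypeNotL2            -- ★ `nonempty_equiv_of_thetaTypeAtCM`: a theta-type class IS `⟦X_v ∘ κ_v⁻¹⟧` (Howe irreducibility inside)
import Literature.NumberTheory.GelbartRogawski1991.CMThetaTypeVocabulary                -- ★ `ThetaTypeAtCM`, `xThetaCM` (the statement's currency)
import HarnessLib

/-!
# K2_E2 «WeilCharacterThetaRoad» — brick (D2) `StubThetaTypeUnique` PAID: «the CM theta type at a fixed line `⟨ε⟩` is ONE class of `U(H)(L⁺_v)`»

Cell `pub/hodgecm-mathlib`, Track B «K2-LIT», ENGINE E2; crux H413 = `stmt-HodgeConjecture-24833` (lane `--supports`), route HCCMUnconditional; seat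
`hodgecm-mathlib-K2E2-p12` (g4), within DEAL (D) of K2E2-plan (g3) 2026-09-04T05:45:50Z (3) (brick (D2) of tier 0 ED. 2's composition `piNOtherTowerThetaType_of_bricks`; the same
lemma, in section-variable form, is `K2E2WPiNOtherTowerThetaType.thetaTypeAtCM_unique` of this seat's (D) file p857823 — restated here BY VALUE on the socket's exact binders so that
the re-point `stub_thetaTypeUnique := K2E2WThetaTypeUnique.thetaTypeUnique_holds` is one token and needs no import of the (D) file).  Target = tier 0
`Cruxes/H413/Lines/K2_E2_WeilCharacterThetaRoad.lean` ED. 2 `def StubThetaTypeUnique` (= `_Sigs` ED. 2 row `sig_K2E2WThetaTypeUnique` :138), statement VERBATIM.  THEOREMS ONLY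
(no `def`, no instance, no notation, no named fact, no `sorry`).  HONEST LABEL: HC_CM is proved only modulo the 7 printed citations (2 remaining named inputs: hLiu418 =
stmt-HodgeConjecture-24832, h413 = stmt-HodgeConjecture-24833) until rung 0 closes; this file proves no printed citation by itself and closes no socket until tied.

THE MATHEMATICS [GelbartRogawski1991 §3.4 p. 458; Moen1987: Howe duality for the compact member `U(1)` — the `χ_v`-isotypic part of the Weil representation is IRREDUCIBLE].
A class `c` of `U(H)(L⁺_v)` «IS the theta type `X_v(μ, ε, χ_f) ∘ κ_v⁻¹`» (★ `ThetaTypeAtCM`) iff, read on `localPi … H v` (★ `localPiEquiv`), its representatives are equivalent to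
`πH := X_v ∘ κ_v⁻¹` (★ `F0P2oThetaTypeNotL2.nonempty_equiv_of_thetaTypeAtCM`, over ★ `isIrreducible_xThetaCM`).  Two such classes `c, c'` therefore have equivalent
representatives (`e.trans e'.symm`), hence equal images under the injective ★ `IrrClass.comap (localPiEquiv …)` (★ `IrrClass.comap_injective`), hence `c = c'`.
The non-split hypothesis of the socket is not used.

## References
* [GelbartRogawski1991] S. Gelbart, J. Rogawski, Invent. Math. 105 (1991): §3.4 p. 458; §5.1 (5.1.1) p. 465, Lem. 5.1.2 p. 466.
* [Moen1987] C. Moen, *The dual pair (U(3), U(1)) over a p-adic field*, Pacific J. Math. 127 (1987): Theorem p. 141.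
* [Liu2021] Y. Liu, Camb. J. Math. 9 (2021): Def. 4.11 (l. 2090–2096).
* [BushnellHenniart2006] C. Bushnell, G. Henniart, Grundlehren 335 (2006): §1.1 (isomorphism classes).
-/

set_option autoImplicit false
-- the mandated namespace repeats the single-problem summit's segment (`HodgeConjecture.HodgeConjecture`)
set_option linter.dupNamespace false

noncomputable section

open NumberField IsDedekindDomain MeasureTheory
open scoped Matrix ComplexOrder

namespace Summit.HodgeConjecture.HodgeConjecture.Cruxes.H413.K2E2WThetaTypeUnique

open Literature.NumberTheory Literature.NumberTheory.Automorphic Literature.NumberTheory.Automorphic.UnitaryGroup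
open Literature.NumberTheory.Automorphic.IdeleClassGroup
open Literature.NumberTheory.Automorphic.Liu2021 Literature.NumberTheory.Automorphic.Liu2021.Def411WeilCarriers
open Literature.NumberTheory.GaloisRepresentations
open Literature.NumberTheory.Rogawski1990 Literature.NumberTheory.GelbartRogawski1991
open Summit.HodgeConjecture.HodgeConjecture.Cruxes.H413

set_option synthInstance.maxHeartbeats 400000 in
set_option maxHeartbeats 8000000 in -- MEASURED (as ★ `F0P2oThetaTypeNotL2.nonempty_equiv_of_thetaTypeAtCM`): the `xThetaCM ∘ κ_v⁻¹` abbreviations are heavy to elaborate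
/-- **(D2) «THE THETA TYPE AT A FIXED LINE IS ONE CLASS» — `StubThetaTypeUnique` of tier 0 `Lines/K2_E2_WeilCharacterThetaRoad.lean` ED. 2, statement VERBATIM.**  For the CM
frame `ᵗ(c̄ g) H g = diag dV`, `μ` conjugate-symplectic, `χ_f` continuous unitary, a finite `v` (the non-split hypothesis is carried, not used) and a line `ε`: two classes `c, c'`
of `U(H)(L⁺_v)` which ARE the theta type `X_v(μ, ε, χ_f) ∘ κ_v⁻¹` coincide (★ `nonempty_equiv_of_thetaTypeAtCM` twice, `Representation.Equiv.trans`, ★ `IrrClass.mk_eq_mk_of_equiv`,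
★ `IrrClass.comap_injective`). [cite: GelbartRogawski1991, §3.4 p. 458; Lem. 5.1.2 p. 466] [cite: Moen1987, Thm. p. 141] [cite: BushnellHenniart2006, §1.1] -/
theorem thetaTypeUnique_holds :
  ∀ (L : Type) [Field L] [NumberField L] [IsCMField L] (H : Matrix (Fin 3) (Fin 3) L) {n' : ℕ} (e₁ : Fin 3 × Fin 1 ≃ Fin n')
    (dV : Fin 3 → L) (hdV : ∀ i, IsCMField.complexConj L (dV i) = dV i) (hdV0 : ∀ i, dV i ≠ 0) (g : GL (Fin 3) L)
    (hg : ((g : Matrix (Fin 3) (Fin 3) L).map (cmConjRingHom L))ᵀ * H * (g : Matrix (Fin 3) (Fin 3) L) = Matrix.diagonal dV)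
    (μ : Literature.NumberTheory.Automorphic.IdeleClassGroup L →ₜ* Circle) (hμ : IsConjugateSymplectic L μ)
    (χf : UnitaryGroup.finAdelicOne (↥(maximalRealSubfield L)) L (IsCMField.complexConj L) →* ℂˣ),
    Continuous χf → (∀ z, ‖((χf z : ℂˣ) : ℂ)‖ = 1) →
    ∀ (v : HeightOneSpectrum (𝓞 ↥(maximalRealSubfield L))), (∀ w : PlacesOver L v, IsCMField.complexConj L • w.1 = w.1) →
    ∀ (ε : (↥(maximalRealSubfield L))ˣ) (c c' : IrrClass ((cmDatum L 3 H).Local v)),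
      ThetaTypeAtCM L H e₁ dV hdV hdV0 g hg μ hμ χf ε v c → ThetaTypeAtCM L H e₁ dV hdV hdV0 g hg μ hμ χf ε v c' → c = c' := by
  intro L _ _ _ H n' e₁ dV hdV hdV0 g hg μ hμ χf hcont hunit v _hv ε c c' hθ hθ'
  obtain ⟨r, hr⟩ := IrrClass.mk_surjective (IrrClass.comap (localPiEquiv L (IsCMField.complexConj L) 3 H v) c)
  obtain ⟨r', hr'⟩ := IrrClass.mk_surjective (IrrClass.comap (localPiEquiv L (IsCMField.complexConj L) 3 H v) c')
  obtain ⟨e⟩ := F0P2oThetaTypeNotL2.nonempty_equiv_of_thetaTypeAtCM L H e₁ dV hdV hdV0 g hg μ hμ χf hcont hunit ε v c hθ r hr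
  obtain ⟨e'⟩ := F0P2oThetaTypeNotL2.nonempty_equiv_of_thetaTypeAtCM L H e₁ dV hdV hdV0 g hg μ hμ χf hcont hunit ε v c' hθ' r' hr'
  refine IrrClass.comap_injective (localPiEquiv L (IsCMField.complexConj L) 3 H v) ?_
  rw [← hr, ← hr']
  exact IrrClass.mk_eq_mk_of_equiv (e.trans e'.symm)

end Summit.HodgeConjecture.HodgeConjecture.Cruxes.H413.K2E2WThetaTypeUnique

end
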